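import Literature.LinearAlgebra.Matrix.ReducedEchelonBasis
import Literature.NumberTheory.Automorphic.SatakeParametersGL
import HarnessLib

/-!
# Left cosets of the Hecke double cosets `GL_n(𝒪) diag(ϖ 1_r, 1_{n-r}) GL_n(𝒪)`: the transversal
`{u_a ϖ^{ε_S}}`

Topic `NumberTheory/Automorphic`; namespaces `Literature.Echelon` (matrix algebra of echelon unipotents,
any commutative ring) and `Literature.Automorphic` (the valuation ring `𝒪 = 𝒪[F]` of a field `F` with a
`ValuativeRel`, `K₀ = GL_n(𝒪) = glInt n F` of `ReductiveGroupData`, the Hecke diagonal matrices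
`t_r = heckeDiag n ϖ r = diag(ϖ, …, ϖ, 1, …, 1)` and operators `heckeT` of `SatakeParametersGL`).
Everything is proved.

**Theorem** (`bijOn_heckeTransversal`). Let `ϖ ∈ 𝒪` be non-zero and generate the maximal ideal
(`IsUniformizingElement`; every uniformizer of a non-archimedean local field), `𝓀 = 𝒪/ϖ`, and
`0 ≤ r ≤ n`. Then the matrices
`u_a ϖ^{ε_S}`, where `S ⊆ {1, …, n}` has `n - r` elements, `ε_S` is the indicator of the complement
of `S`, `ā : {(i, j) : i < j, i ∉ S, j ∈ S} → 𝓀` is arbitrary (a reduced echelon table with pivots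
`S`, `ReducedEchelonBasis.IsEchelonData`), `a` is its lift by a fixed section of `𝒪 → 𝓀`, and
`u_a = 1 + (a_{ij})` (`Literature.NumberTheory.Automorphic.Echelon.echelonMatrix`), form a complete system of representatives of
`K₀ t_r K₀ / K₀`:
`K₀ diag(ϖ 1_r, 1_{n-r}) K₀ = ⨆_{(S, ā)} u_a ϖ^{ε_S} K₀`.
Consequently (`heckeT_apply_eq_sum`, via `heckeOperator_apply_eq_sum` of `HeckeAlgebra`) the Hecke
operator `T_r` acts on `K₀`-fixed vectors by `T_r v = ∑_{(S, ā)} ρ(u_a ϖ^{ε_S}) v`, and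
(`sum_transversalIndex_of_fst`, `card_isEchelonData`) a summand depending only on `S` is counted
`q^{c(S)}` times, `c(S) = #{(i, j) : i < j, i ∉ S, j ∈ S}` (`∑_{#S = n-r} q^{c(S)}` is the Gaussian
binomial coefficient, the number of left cosets).

This is the classical coset decomposition behind the Satake parameters of `GL_n` (Shimura,
*Introduction to the arithmetic theory of automorphic functions*, §3.2; Tamagawa 1963) and behind
Shintani's computation of the class-one Whittaker function (Shintani 1976; Miyauchi 2014, Lemma 2,
gives an inductive form of the same system of representatives). It is the group-theoretic input
of the unramified Rankin–Selberg computation (Jacquet–Shalika 1981, §2), the remaining bricks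
being Shintani's formula itself (from the dual Pieri recursion,
`Literature/RingTheory/SymmetricFunctions/SchurPolynomials.lean`) and the torus integral.

## Proof

* *Cosets in the double coset* (`heckeRep_mem_orbit`): `ϖ^{ε_S} = P_σ t_r P_σ⁻¹` for a permutation
  matrix `P_σ ∈ K₀` (`exists_perm_lt_iff_not_mem`, `permGL_mul_heckeDiag`), and `u_a ∈ K₀`.
* *Injectivity* (`eq_of_inv_heckeRep_mul_heckeRep_mem`): the `u_a` with a fixed pivot set form an
  abelian group, `u_a u_b = u_{a+b}` (`echelonMatrix_mul`); the diagonal of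
  `(u_a ϖ^{ε_S})⁻¹ u_{a'} ϖ^{ε_{S'}}` contains `ϖ⁻¹ ∉ 𝒪` unless `S' ⊆ S`, and for `S = S'` its
  `(i, j)` entry (`i ∉ S`, `j ∈ S`) is `ϖ⁻¹ (a'_{ij} - a_{ij})`, integral only if `ā = ā'`.
* *Surjectivity* (`exists_heckeRep_inv_mul_mem`): for `k ∈ K₀` let `(S, ā)` be the reduced echelon
  basis (`exists_echelon_basis`, by Gaussian elimination over `𝓀`) of the span of the last `n - r`
  columns of `k mod ϖ`; then `(u_a ϖ^{ε_S})⁻¹ k t_r` is integral with unit determinant, because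
  `u_{-ā}` maps that span onto `⊕_{j ∈ S} 𝓀 e_j` (`echelonMatrix_neg_mulVec_apply_eq_zero`).
* *Membership in `K₀`* is tested by `mem_glInt_of_isIntegralMatrix` (integral entries and
  determinant of valuation `1`).

## References

* G. Shimura, *Introduction to the arithmetic theory of automorphic functions* (1971), §3.2.
* M. Miyauchi, *Whittaker functions associated to newforms for GL(n) over p-adic fields*, J. Math.
  Soc. Japan 66 (2014) = arXiv:1201.3507, Lemma 2 (a complete system of representatives of
  `K_m / K_m ∩ ϖ^{f^i} K_m ϖ^{-f^i}`).
* T. Shintani, Proc. Japan Acad. 52 (1976), 180–182.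
-/

noncomputable section

/-! ## Echelon unipotents and their algebra -/

namespace Literature.NumberTheory.Automorphic.Echelon

open Matrix Finset

variable {R : Type*} [CommRing R] {n : ℕ}

/-- The **echelon unipotent** `u_a = (δ_{ij} + [i ≠ j] a_{ij})_{i,j}`: its `j`-th column is the
echelon vector `v_j` of `ReducedEchelonBasis` (`echelonMatrix_mulVec_single`). For a table
supported strictly above the diagonal it is upper unitriangular. [folklore] -/
def echelonMatrix (a : Fin n → Fin n → R) : Matrix (Fin n) (Fin n) R :=
  Matrix.of fun i j => if i = j then 1 else a i j

/-- Diagonal entries of `u_a` are `1`. [folklore] -/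
@[simp] theorem echelonMatrix_apply_self (a : Fin n → Fin n → R) (i : Fin n) :
    echelonMatrix a i i = 1 := by simp [echelonMatrix]

/-- Off-diagonal entries of `u_a` are `a_{ij}`. [folklore] -/
theorem echelonMatrix_apply_of_ne (a : Fin n → Fin n → R) {i j : Fin n} (h : i ≠ j) :
    echelonMatrix a i j = a i j := by simp [echelonMatrix, h]

/-- `a` is supported on `Sᶜ × S`: `a_{ij} ≠ 0 ⇒ i ∉ S ∧ j ∈ S`. [folklore] -/
def IsEchelonSupported (S : Finset (Fin n)) (a : Fin n → Fin n → R) : Prop :=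
  ∀ i j, a i j ≠ 0 → i ∉ S ∧ j ∈ S

/-- Rows in `S` of an `Sᶜ × S`-supported table vanish. [folklore] -/
theorem IsEchelonSupported.apply_eq_zero_left {S : Finset (Fin n)} {a : Fin n → Fin n → R}
    (h : IsEchelonSupported S a) {i : Fin n} (hi : i ∈ S) (j : Fin n) : a i j = 0 := by
  by_contra hne; exact (h i j hne).1 hi

/-- Columns outside `S` of an `Sᶜ × S`-supported table vanish. [folklore] -/
theorem IsEchelonSupported.apply_eq_zero_right {S : Finset (Fin n)} {a : Fin n → Fin n → R}
    (h : IsEchelonSupported S a) (i : Fin n) {j : Fin n} (hj : j ∉ S) : a i j = 0 := by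
  by_contra hne; exact hj (h i j hne).2

/-- `Sᶜ × S`-support is closed under addition. [folklore] -/
theorem IsEchelonSupported.add {S : Finset (Fin n)} {a b : Fin n → Fin n → R}
    (ha : IsEchelonSupported S a)
    (hb : IsEchelonSupported S b) : IsEchelonSupported S (a + b) := by
  intro i j hij
  by_cases h1 : a i j = 0
  · have : b i j ≠ 0 := by simpa [h1] using hij
    exact hb i j this
  · exact ha i j h1

/-- `Sᶜ × S`-support is closed under negation. [folklore] -/
theorem IsEchelonSupported.neg {S : Finset (Fin n)} {a : Fin n → Fin n → R}
    (ha : IsEchelonSupported S a) :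
    IsEchelonSupported S (-a) := fun i j hij => ha i j (by simpa using hij)

/-- **The `u_a` (fixed pivot set) form an abelian group**: `u_a u_b = u_{a+b}` for `a, b`
supported on `Sᶜ × S` — the cross terms `a_{il} b_{lj}` need `l ∈ S` and `l ∉ S`. [folklore] -/
theorem echelonMatrix_mul {S : Finset (Fin n)} {a b : Fin n → Fin n → R}
    (ha : IsEchelonSupported S a)
    (hb : IsEchelonSupported S b) : echelonMatrix a * echelonMatrix b = echelonMatrix (a + b) := by
  ext i j
  rw [Matrix.mul_apply]
  by_cases hij : i = j
  · subst hij
    rw [echelonMatrix_apply_self, Finset.sum_eq_single i]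
    · simp
    · intro l _ hl
      rw [echelonMatrix_apply_of_ne _ (Ne.symm hl), echelonMatrix_apply_of_ne _ hl]
      by_cases hl' : l ∈ S
      · rw [hb.apply_eq_zero_left hl', mul_zero]
      · rw [ha.apply_eq_zero_right i hl', zero_mul]
    · intro h; exact absurd (Finset.mem_univ i) h
  · rw [echelonMatrix_apply_of_ne _ hij, Finset.sum_eq_add_of_mem i j (mem_univ i) (mem_univ j) hij]
    · simp [echelonMatrix_apply_of_ne _ hij, add_comm]
    · intro l _ hl
      rw [echelonMatrix_apply_of_ne _ (Ne.symm hl.1), echelonMatrix_apply_of_ne _ hl.2]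
      by_cases hl' : l ∈ S
      · rw [hb.apply_eq_zero_left hl', mul_zero]
      · rw [ha.apply_eq_zero_right i hl', zero_mul]

/-- `u_0 = 1`. [folklore] -/
theorem echelonMatrix_zero : echelonMatrix (0 : Fin n → Fin n → R) = 1 := by
  ext i j
  by_cases h : i = j
  · subst h; simp
  · rw [echelonMatrix_apply_of_ne _ h, Matrix.one_apply_ne h]; rfl

/-- `u_a u_{-a} = 1`. [folklore] -/
theorem echelonMatrix_mul_neg {S : Finset (Fin n)} {a : Fin n → Fin n → R}
    (ha : IsEchelonSupported S a) :
    echelonMatrix a * echelonMatrix (-a) = 1 := by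
  rw [echelonMatrix_mul ha ha.neg, add_neg_cancel, echelonMatrix_zero]

/-- `u_{-a} u_a = 1`. [folklore] -/
theorem echelonMatrix_neg_mul {S : Finset (Fin n)} {a : Fin n → Fin n → R}
    (ha : IsEchelonSupported S a) :
    echelonMatrix (-a) * echelonMatrix a = 1 := by
  rw [echelonMatrix_mul ha.neg ha, neg_add_cancel, echelonMatrix_zero]

/-- The `j`-th column of `u_a` is the echelon vector `v_j`. [folklore] -/
theorem echelonMatrix_mulVec_single {k : Type*} [Field k] (a : Fin n → Fin n → k) (j : Fin n) :
    (echelonMatrix a).mulVec (Pi.single j 1) = Literature.LinearAlgebra.Matrix.Echelon.echelonVec a j := by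
  ext i
  simp [Matrix.mulVec, echelonMatrix, Literature.LinearAlgebra.Matrix.Echelon.echelonVec, dotProduct, Pi.single_apply]

/-- `(u_a)_{ij} = v_j(i)`. [folklore] -/
theorem echelonMatrix_apply_eq_echelonVec {k : Type*} [Field k] (a : Fin n → Fin n → k)
    (i j : Fin n) : echelonMatrix a i j = Literature.LinearAlgebra.Matrix.Echelon.echelonVec a j i := by
  simp [echelonMatrix, Literature.LinearAlgebra.Matrix.Echelon.echelonVec]

/-- Reduced echelon data is supported on `Sᶜ × S`. [folklore] -/
theorem _root_.Literature.LinearAlgebra.Matrix.Echelon.IsEchelonData.isEchelonSupported {k : Type*} [Field k] {S : Finset (Fin n)}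
    {a : Fin n → Fin n → k} (h : Literature.LinearAlgebra.Matrix.Echelon.IsEchelonData S a) : IsEchelonSupported S a :=
  fun i j hij => ⟨(h i j hij).2.1, (h i j hij).2.2⟩

/-! ### Diagonal powers `ϖ^ε` and conjugation -/

/-- The diagonal matrix `ϖ^ε = diag(ϖ^{ε_i})`. [folklore] -/
def piPow (ϖ : R) (ε : Fin n → ℕ) : Matrix (Fin n) (Fin n) R := Matrix.diagonal fun i => ϖ ^ ε i

/-- Entries of `ϖ^ε`. [folklore] -/
theorem piPow_apply (ϖ : R) (ε : Fin n → ℕ) (i j : Fin n) :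
    piPow ϖ ε i j = if i = j then ϖ ^ ε i else 0 := by
  simp [piPow, Matrix.diagonal_apply]

/-- `(M ϖ^ε)_{ij} = M_{ij} ϖ^{ε_j}`. [folklore] -/
theorem mul_piPow_apply (M : Matrix (Fin n) (Fin n) R) (ϖ : R) (ε : Fin n → ℕ) (i j : Fin n) :
    (M * piPow ϖ ε) i j = M i j * ϖ ^ ε j := by
  simp [piPow, Matrix.mul_diagonal]

/-- `(ϖ^ε M)_{ij} = ϖ^{ε_i} M_{ij}`. [folklore] -/
theorem piPow_mul_apply (M : Matrix (Fin n) (Fin n) R) (ϖ : R) (ε : Fin n → ℕ) (i j : Fin n) :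
    (piPow ϖ ε * M) i j = ϖ ^ ε i * M i j := by
  simp [piPow, Matrix.diagonal_mul]

/-- `det ϖ^ε = ϖ^{|ε|}`. [folklore] -/
theorem det_piPow (ϖ : R) (ε : Fin n → ℕ) : (piPow ϖ ε).det = ϖ ^ (∑ i, ε i) := by
  simp [piPow, Matrix.det_diagonal, Finset.prod_pow_eq_pow_sum]

/-- `det u_a = 1` for `a` supported strictly above the diagonal. [folklore] -/
theorem det_echelonMatrix {a : Fin n → Fin n → R} (h : ∀ i j, a i j ≠ 0 → i < j) :
    (echelonMatrix a).det = 1 := by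
  have hT : (echelonMatrix a).BlockTriangular id := by
    intro i j hij
    have hij' : j < i := hij
    have hne : i ≠ j := ne_of_gt hij'
    show echelonMatrix a i j = 0
    rw [echelonMatrix_apply_of_ne _ hne]
    by_contra hne'
    exact absurd (h i j hne') (not_lt.mpr hij'.le)
  rw [Matrix.det_of_upperTriangular hT]
  simp

end Literature.NumberTheory.Automorphic.Echelon

/-! ## Integral matrices over the valuation ring and `GL_n(𝒪)` -/

namespace Literature.NumberTheory.Automorphic

open ValuativeRel Matrix Finset Echelon Literature.LinearAlgebra.Matrix.Echelon

variable {F : Type*} [Field F] [ValuativeRel F] {n : ℕ}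

/-- All entries of the matrix lie in the valuation ring `𝒪 = 𝒪[F]`. [folklore] -/
def IsIntegralMatrix (M : Matrix (Fin n) (Fin n) F) : Prop := ∀ i j, M i j ∈ 𝒪[F]

/-- Products of integral matrices are integral. [folklore] -/
theorem IsIntegralMatrix.mul {M N : Matrix (Fin n) (Fin n) F} (hM : IsIntegralMatrix M)
    (hN : IsIntegralMatrix N) : IsIntegralMatrix (M * N) := fun i j => by
  rw [Matrix.mul_apply]
  exact Subring.sum_mem _ fun l _ => Subring.mul_mem _ (hM i l) (hN l j)

/-- `1` is integral. [folklore] -/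
theorem IsIntegralMatrix.one : IsIntegralMatrix (1 : Matrix (Fin n) (Fin n) F) := fun i j => by
  rw [Matrix.one_apply]
  split_ifs
  · exact Subring.one_mem _
  · exact Subring.zero_mem _

/-- An integral matrix is the image of a matrix over `𝒪`. [folklore] -/
theorem IsIntegralMatrix.exists_map {M : Matrix (Fin n) (Fin n) F} (hM : IsIntegralMatrix M) :
    ∃ M₀ : Matrix (Fin n) (Fin n) 𝒪[F], M₀.map (𝒪[F]).subtype = M :=
  ⟨Matrix.of fun i j => ⟨M i j, hM i j⟩, by ext i j; rfl⟩

/-- The determinant of an integral matrix is integral. [folklore] -/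
theorem IsIntegralMatrix.det_mem {M : Matrix (Fin n) (Fin n) F} (hM : IsIntegralMatrix M) :
    M.det ∈ 𝒪[F] := by
  obtain ⟨M₀, rfl⟩ := hM.exists_map
  rw [← RingHom.mapMatrix_apply, ← RingHom.map_det]
  exact (M₀.det).2

/-- The adjugate of an integral matrix is integral. [folklore] -/
theorem IsIntegralMatrix.adjugate {M : Matrix (Fin n) (Fin n) F} (hM : IsIntegralMatrix M) :
    IsIntegralMatrix M.adjugate := by
  obtain ⟨M₀, rfl⟩ := hM.exists_map
  intro i j
  rw [← RingHom.mapMatrix_apply, ← RingHom.map_adjugate]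
  exact (M₀.adjugate i j).2

/-- Elements of `GL_n(𝒪)` (`glInt`) are integral. [folklore] -/
theorem isIntegralMatrix_of_mem_glInt {g : GL (Fin n) F} (hg : g ∈ glInt n F) :
    IsIntegralMatrix (g : Matrix (Fin n) (Fin n) F) := ((mem_glInt_iff g).mp hg).1

/-- Inverses of elements of `GL_n(𝒪)` are integral. [folklore] -/
theorem isIntegralMatrix_inv_of_mem_glInt {g : GL (Fin n) F} (hg : g ∈ glInt n F) :
    IsIntegralMatrix ((g⁻¹ : GL (Fin n) F) : Matrix (Fin n) (Fin n) F) :=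
        ((mem_glInt_iff g).mp hg).2

/-- The determinant of an element of `GL_n(𝒪)` has valuation `1` (it and its inverse are
integral). [folklore] -/
theorem valuation_det_eq_one_of_mem_glInt {g : GL (Fin n) F} (hg : g ∈ glInt n F) :
    valuation F (g : Matrix (Fin n) (Fin n) F).det = 1 := by
  have h1 := (Valuation.mem_integer_iff _ _).mp (isIntegralMatrix_of_mem_glInt hg).det_mem
  have h2 := (Valuation.mem_integer_iff _ _).mp (isIntegralMatrix_inv_of_mem_glInt hg).det_mem
  have hprod : (g : Matrix (Fin n) (Fin n) F).det * ((g⁻¹ : GL (Fin n) F) : Matrix (Fin n)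
      (Fin n) F).det = 1 := by
    rw [← Matrix.det_mul, ← Units.val_mul, mul_inv_cancel, Units.val_one, Matrix.det_one]
  have hv : valuation F (g : Matrix (Fin n) (Fin n) F).det *
      valuation F ((g⁻¹ : GL (Fin n) F) : Matrix (Fin n) (Fin n) F).det = 1 := by
    rw [← map_mul, hprod, map_one]
  refine le_antisymm h1 ?_
  by_contra hlt
  rw [not_le] at hlt
  have := mul_lt_one_of_lt_of_le hlt h2
  rw [hv] at this
  exact lt_irrefl _ this

/-- **Membership in `GL_n(𝒪)`**: an integral matrix whose determinant has valuation `1` lies in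
`glInt n F` (the inverse is `det⁻¹ · adj`). [folklore] -/
theorem mem_glInt_of_isIntegralMatrix {g : GL (Fin n) F} (hg : IsIntegralMatrix (g : Matrix
    (Fin n) (Fin n) F))
    (hdet : valuation F (g : Matrix (Fin n) (Fin n) F).det = 1) : g ∈ glInt n F := by
  rw [mem_glInt_iff]
  refine ⟨hg, fun i j => ?_⟩
  rw [Matrix.coe_units_inv, Matrix.inv_def, Matrix.smul_apply, smul_eq_mul]
  refine Subring.mul_mem _ ?_ (hg.adjugate i j)
  -- `(det g)⁻¹ ∈ 𝒪` since `det g` is a unit of `𝒪`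
  rw [Ring.inverse_eq_inv', Valuation.mem_integer_iff, map_inv₀, hdet, inv_one]

/-- Entries of elements of `GL_n(𝒪)` have valuation `≤ 1`. [folklore] -/
theorem valuation_apply_le_one_of_mem_glInt {g : GL (Fin n) F} (hg : g ∈ glInt n F) (i j : Fin n) :
    valuation F ((g : Matrix (Fin n) (Fin n) F) i j) ≤ 1 :=
  (Valuation.mem_integer_iff _ _).mp (isIntegralMatrix_of_mem_glInt hg i j)

/-! ### Residues and lifts -/

/-- A set-theoretic section `𝓀 → 𝒪` of the residue map with `0 ↦ 0` (any complete residue system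
would do). [folklore] -/
noncomputable def liftRes (x : 𝓀[F]) : 𝒪[F] := by
  classical
  exact if x = 0 then 0 else Function.surjInv (IsLocalRing.residue_surjective (R := 𝒪[F])) x

/-- `liftRes` is a section of the residue map. [folklore] -/
@[simp] theorem residue_liftRes (x : 𝓀[F]) : IsLocalRing.residue 𝒪[F] (liftRes x) = x := by
  classical
  unfold liftRes
  split_ifs with h
  · rw [h, map_zero]
  · exact Function.surjInv_eq _ _

/-- `liftRes 0 = 0`. [folklore] -/
@[simp] theorem liftRes_zero : liftRes (0 : 𝓀[F]) = 0 := by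
  classical
  simp [liftRes]

/-- `liftRes x ≠ 0` for `x ≠ 0`. [folklore] -/
theorem liftRes_ne_zero {x : 𝓀[F]} (hx : x ≠ 0) : liftRes x ≠ 0 := by
  intro h
  apply hx
  rw [← residue_liftRes x, h, map_zero]

/-- An element of `𝒪` with residue `0` is a non-unit: valuation `< 1`. [folklore] -/
theorem valuation_lt_one_of_residue_eq_zero {x : 𝒪[F]} (hx : IsLocalRing.residue 𝒪[F] x = 0) :
    valuation F (x : F) < 1 := by
  rw [IsLocalRing.residue_eq_zero_iff, IsLocalRing.mem_maximalIdeal, mem_nonunits_iff,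
    (Valuation.integer.integers (valuation F)).isUnit_iff_valuation_eq_one] at hx
  exact lt_of_le_of_ne ((Valuation.mem_integer_iff _ _).mp x.2) hx

/-- An element of `𝒪` of valuation `< 1` has residue `0`. [folklore] -/
theorem residue_eq_zero_of_valuation_lt_one {x : 𝒪[F]} (hx : valuation F (x : F) < 1) :
    IsLocalRing.residue 𝒪[F] x = 0 := by
  rw [IsLocalRing.residue_eq_zero_iff, IsLocalRing.mem_maximalIdeal, mem_nonunits_iff,
    (Valuation.integer.integers (valuation F)).isUnit_iff_valuation_eq_one]
  exact hx.ne

/-! ### Uniformizers -/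

/-- `ϖ ∈ 𝒪` is non-zero and generates the maximal ideal of `𝒪 = 𝒪[F]` — the uniformizer hypothesis
of this file; for a non-archimedean local field these are exactly the uniformizers
(`IsDiscreteValuationRing.irreducible_iff_uniformizer`). [folklore] -/
structure IsUniformizingElement (ϖ : F) : Prop where
  mem : ϖ ∈ 𝒪[F]
  ne_zero : ϖ ≠ 0
  span_eq : IsLocalRing.maximalIdeal 𝒪[F] = Ideal.span {(⟨ϖ, mem⟩ : 𝒪[F])}

namespace IsUniformizingElement

variable {ϖ : F}

/-- A uniformizing element has valuation `< 1`. [folklore] -/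
theorem valuation_lt_one (h : IsUniformizingElement ϖ) : valuation F ϖ < 1 := by
  have : (⟨ϖ, h.mem⟩ : 𝒪[F]) ∈ IsLocalRing.maximalIdeal 𝒪[F] := by
    rw [h.span_eq]; exact Ideal.mem_span_singleton_self _
  rw [IsLocalRing.mem_maximalIdeal, mem_nonunits_iff,
    (Valuation.integer.integers (valuation F)).isUnit_iff_valuation_eq_one] at this
  exact lt_of_le_of_ne ((Valuation.mem_integer_iff _ _).mp h.mem) this

/-- A uniformizing element has valuation `≤ 1`. [folklore] -/
theorem valuation_le_one (h : IsUniformizingElement ϖ) : valuation F ϖ ≤ 1 := h.valuation_lt_one.le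

/-- Elements of `𝒪` of valuation `< 1` are multiples of `ϖ`. [folklore] -/
theorem exists_eq_mul (h : IsUniformizingElement ϖ) {x : F} (hx : x ∈ 𝒪[F])
    (hlt : valuation F x < 1) : ∃ y ∈ 𝒪[F], x = ϖ * y := by
  have hmem : (⟨x, hx⟩ : 𝒪[F]) ∈ IsLocalRing.maximalIdeal 𝒪[F] := by
    rw [IsLocalRing.mem_maximalIdeal, mem_nonunits_iff,
      (Valuation.integer.integers (valuation F)).isUnit_iff_valuation_eq_one]
    exact hlt.ne
  rw [h.span_eq, Ideal.mem_span_singleton'] at hmem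
  obtain ⟨y, hy⟩ := hmem
  refine ⟨y, y.2, ?_⟩
  have := congrArg Subtype.val hy
  simp only [Subring.coe_mul] at this
  rw [← this, mul_comm]

/-- `ϖ⁻¹ x ∈ 𝒪` for `x ∈ 𝒪` of valuation `< 1`. [folklore] -/
theorem inv_mul_mem (h : IsUniformizingElement ϖ) {x : F} (hx : x ∈ 𝒪[F])
    (hlt : valuation F x < 1) :
    ϖ⁻¹ * x ∈ 𝒪[F] := by
  obtain ⟨y, hy, rfl⟩ := h.exists_eq_mul hx hlt
  rwa [← mul_assoc, inv_mul_cancel₀ h.ne_zero, one_mul]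

/-- `ϖ⁻¹ ∉ 𝒪`. [folklore] -/
theorem inv_not_mem (h : IsUniformizingElement ϖ) : ϖ⁻¹ ∉ 𝒪[F] := by
  rw [Valuation.mem_integer_iff, map_inv₀, not_le]
  exact one_lt_inv₀ ((Valuation.pos_iff _).mpr h.ne_zero) |>.mpr h.valuation_lt_one

/-- `ϖ^m ∈ 𝒪`. [folklore] -/
theorem pow_mem (h : IsUniformizingElement ϖ) (m : ℕ) : ϖ ^ m ∈ 𝒪[F] := Subring.pow_mem _ h.mem m

end IsUniformizingElement

end Literature.NumberTheory.Automorphic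

/-! ## The representatives `u_a ϖ^{ε_S}` -/

namespace Literature.NumberTheory.Automorphic

open ValuativeRel Matrix Finset Echelon Literature.LinearAlgebra.Matrix.Echelon

variable {F : Type*} [Field F] [ValuativeRel F] {n : ℕ}

/-- Entrywise lift `𝓀 → 𝒪 ⊆ F` of a residue table. [folklore] -/
noncomputable def liftTable (ā : Fin n → Fin n → 𝓀[F]) : Fin n → Fin n → F :=
  fun i j => (liftRes (ā i j) : F)

/-- Lifted tables are integral. [folklore] -/
theorem liftTable_mem (ā : Fin n → Fin n → 𝓀[F]) (i j : Fin n) : liftTable ā i j ∈ 𝒪[F] :=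
  (liftRes (ā i j)).2

/-- A lifted entry vanishes iff the residue entry does. [folklore] -/
theorem liftTable_eq_zero_iff {ā : Fin n → Fin n → 𝓀[F]} {i j : Fin n} :
    liftTable ā i j = 0 ↔ ā i j = 0 := by
  unfold liftTable
  rw [ZeroMemClass.coe_eq_zero]
  constructor
  · intro h
    by_contra hne
    exact liftRes_ne_zero hne h
  · intro h
    rw [h, liftRes_zero]

/-- The residue of a lifted entry is the original entry. [folklore] -/
theorem residue_liftTable (ā : Fin n → Fin n → 𝓀[F]) (i j : Fin n) :
    IsLocalRing.residue 𝒪[F] ⟨liftTable ā i j, liftTable_mem ā i j⟩ = ā i j := by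
  unfold liftTable
  simp

/-- Lifting preserves reduced echelon data (same pivots, same support). [folklore] -/
theorem isEchelonData_liftTable {S : Finset (Fin n)} {ā : Fin n → Fin n → 𝓀[F]}
    (h : IsEchelonData S ā) : IsEchelonData S (liftTable ā) := fun i j hij =>
  h i j (fun h0 => hij (liftTable_eq_zero_iff.mpr h0))

/-- `ε_S`, the indicator of the complement of the pivot set `S` (exponents of `ϖ` in the
representative: `ϖ` on the non-pivot columns). [folklore] -/
def epsOf (S : Finset (Fin n)) : Fin n → ℕ := fun i => if i ∈ S then 0 else 1

/-- `ε_S(i) = 0` for `i ∈ S`. [folklore] -/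
theorem epsOf_of_mem {S : Finset (Fin n)} {i : Fin n} (h : i ∈ S) : epsOf S i = 0
    := by simp [epsOf, h]

/-- `ε_S(i) = 1` for `i ∉ S`. [folklore] -/
theorem epsOf_of_not_mem {S : Finset (Fin n)} {i : Fin n} (h : i ∉ S) : epsOf S i = 1 := by
  simp [epsOf, h]

/-- `|ε_S| = n - #S`. [folklore] -/
theorem sum_epsOf (S : Finset (Fin n)) : ∑ i, epsOf S i = n - S.card := by
  simp only [epsOf]
  rw [Finset.sum_ite, Finset.sum_const_zero, zero_add, Finset.sum_const, smul_eq_mul, mul_one,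
    Finset.filter_not, Finset.filter_mem_eq_inter, Finset.univ_inter, Finset.card_univ_sdiff,
    Fintype.card_fin]

/-- The **representative matrix** `u_a ϖ^{ε_S}` attached to reduced echelon data `(S, ā)` over the
residue field: columns `ϖ e_i` (`i ∉ S`) and `e_j + ∑_{i<j, i∉S} a_{ij} e_i` (`j ∈ S`), `a` a
lift of `ā` (Miyauchi 2014, Lemma 2, gives an equivalent inductive system of representatives;
classical, e.g. Shimura, *Introduction to the arithmetic theory of automorphic functions*,
§3.2). [folklore] -/
noncomputable def heckeRepMatrix (ϖ : F) (S : Finset (Fin n)) (ā : Fin n → Fin n → 𝓀[F]) :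
    Matrix (Fin n) (Fin n) F :=
  echelonMatrix (liftTable ā) * piPow ϖ (epsOf S)

/-- Entries of `u_a ϖ^{ε_S}`. [folklore] -/
theorem heckeRepMatrix_apply (ϖ : F) (S : Finset (Fin n)) (ā : Fin n → Fin n → 𝓀[F]) (i j : Fin n) :
    heckeRepMatrix ϖ S ā i j = echelonMatrix (liftTable ā) i j * ϖ ^ epsOf S j :=
  mul_piPow_apply _ _ _ _ _

/-- `det (u_a ϖ^{ε_S}) = ϖ^{n - #S}`. [folklore] -/
theorem det_heckeRepMatrix (ϖ : F) {S : Finset (Fin n)} {ā : Fin n → Fin n → 𝓀[F]}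
    (h : IsEchelonData S ā) : (heckeRepMatrix ϖ S ā).det = ϖ ^ (n - S.card) := by
  rw [heckeRepMatrix, Matrix.det_mul, det_echelonMatrix (fun i j hij =>
      (isEchelonData_liftTable h i j hij).1), one_mul,
    det_piPow, sum_epsOf]

/-- `u_a` is integral for a lifted table. [folklore] -/
theorem isIntegralMatrix_echelonMatrix_liftTable (ā : Fin n → Fin n → 𝓀[F]) :
    IsIntegralMatrix (echelonMatrix (liftTable ā)) := fun i j => by
  by_cases h : i = j
  · subst h; rw [echelonMatrix_apply_self]; exact Subring.one_mem _
  · rw [echelonMatrix_apply_of_ne _ h]; exact liftTable_mem ā i j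

/-- `ϖ^ε` is integral for `ϖ ∈ 𝒪`. [folklore] -/
theorem isIntegralMatrix_piPow {ϖ : F} (hϖ : ϖ ∈ 𝒪[F]) (ε : Fin n → ℕ) :
    IsIntegralMatrix (piPow ϖ ε) := fun i j => by
  rw [piPow_apply]
  split_ifs
  · exact Subring.pow_mem _ hϖ _
  · exact Subring.zero_mem _

/-- The representatives are integral matrices. [folklore] -/
theorem isIntegralMatrix_heckeRepMatrix {ϖ : F} (hϖ : ϖ ∈ 𝒪[F]) (S : Finset (Fin n))
    (ā : Fin n → Fin n → 𝓀[F]) : IsIntegralMatrix (heckeRepMatrix ϖ S ā) :=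
  (isIntegralMatrix_echelonMatrix_liftTable ā).mul (isIntegralMatrix_piPow hϖ _)

/-- The representative `u_a ϖ^{ε_S}` as an element of `GL_n(F)` (for `ϖ ≠ 0`). [folklore] -/
noncomputable def heckeRep {ϖ : F} (hϖ : ϖ ≠ 0) {S : Finset (Fin n)} {ā : Fin n → Fin n → 𝓀[F]}
    (h : IsEchelonData S ā) : GL (Fin n) F :=
  Matrix.GeneralLinearGroup.mkOfDetNeZero (heckeRepMatrix ϖ S ā)
    (by rw [det_heckeRepMatrix ϖ h]; exact pow_ne_zero _ hϖ)

/-- The matrix of `heckeRep`. [folklore] -/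
theorem coe_heckeRep {ϖ : F} (hϖ : ϖ ≠ 0) {S : Finset (Fin n)} {ā : Fin n → Fin n → 𝓀[F]}
    (h : IsEchelonData S ā) : ((heckeRep hϖ h : GL (Fin n) F) : Matrix (Fin n)
        (Fin n) F) = heckeRepMatrix ϖ S ā :=
  rfl

/-- `u_a ∈ GL_n(F)` for lifted reduced echelon data (determinant `1`). [folklore] -/
noncomputable def echelonGL {S : Finset (Fin n)} {ā : Fin n → Fin n → 𝓀[F]}
    (h : IsEchelonData S ā) :
    GL (Fin n) F :=
  Matrix.GeneralLinearGroup.mkOfDetNeZero (echelonMatrix (liftTable ā))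
    (by rw [det_echelonMatrix (fun i j hij =>
        (isEchelonData_liftTable h i j hij).1)]; exact one_ne_zero)

/-- The matrix of `echelonGL`. [folklore] -/
theorem coe_echelonGL {S : Finset (Fin n)} {ā : Fin n → Fin n → 𝓀[F]} (h : IsEchelonData S ā) :
    ((echelonGL h : GL (Fin n) F) : Matrix (Fin n) (Fin n) F) = echelonMatrix (liftTable ā) := rfl

/-- `u_a ∈ GL_n(𝒪)`. [folklore] -/
theorem echelonGL_mem_glInt {S : Finset (Fin n)} {ā : Fin n → Fin n → 𝓀[F]}
    (h : IsEchelonData S ā) : echelonGL h ∈ glInt n F :=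
  mem_glInt_of_isIntegralMatrix (isIntegralMatrix_echelonMatrix_liftTable ā)
    (by rw [coe_echelonGL, det_echelonMatrix (fun i j hij =>
        (isEchelonData_liftTable h i j hij).1), map_one])

/-- `ϖ^ε ∈ GL_n(F)` for `ϖ ≠ 0`. [folklore] -/
noncomputable def piPowGL {ϖ : F} (hϖ : ϖ ≠ 0) (ε : Fin n → ℕ) : GL (Fin n) F :=
  Matrix.GeneralLinearGroup.mkOfDetNeZero (piPow ϖ ε) (by rw [det_piPow]; exact pow_ne_zero _ hϖ)

omit [ValuativeRel F] in
/-- The matrix of `piPowGL`. [folklore] -/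
theorem coe_piPowGL {ϖ : F} (hϖ : ϖ ≠ 0) (ε : Fin n → ℕ) :
    ((piPowGL hϖ ε : GL (Fin n) F) : Matrix (Fin n) (Fin n) F) = piPow ϖ ε := rfl

/-- `heckeRep = u_a · ϖ^{ε_S}` in `GL_n(F)`. [folklore] -/
theorem heckeRep_eq_mul {ϖ : F} (hϖ : ϖ ≠ 0) {S : Finset (Fin n)} {ā : Fin n → Fin n → 𝓀[F]}
    (h : IsEchelonData S ā) : heckeRep hϖ h = echelonGL h * piPowGL hϖ (epsOf S) :=
  Units.ext rfl

/-! ### Permutation matrices in `GL_n(𝒪)` and the conjugates of `t_r` -/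

omit [ValuativeRel F] in
/-- Entries of Mathlib's permutation matrix: `(P_σ)_{ij} = [σ i = j]`. [folklore] -/
theorem permMatrix_apply' (σ : Equiv.Perm (Fin n)) (i j : Fin n) :
    σ.permMatrix F i j = if σ i = j then 1 else 0 := by
  simp [Equiv.Perm.permMatrix, PEquiv.toMatrix_apply, Equiv.toPEquiv_apply, eq_comm]

/-- A permutation matrix as an element of `GL_n(F)`. [folklore] -/
noncomputable def permGL (σ : Equiv.Perm (Fin n)) : GL (Fin n) F :=
  Matrix.GeneralLinearGroup.mkOfDetNeZero (σ.permMatrix F) (by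
    rw [Matrix.det_permutation]
    rcases Int.units_eq_one_or (Equiv.Perm.sign σ) with h | h <;> simp [h])

omit [ValuativeRel F] in
/-- The matrix of `permGL`. [folklore] -/
theorem coe_permGL (σ : Equiv.Perm (Fin n)) :
    ((permGL σ : GL (Fin n) F) : Matrix (Fin n) (Fin n) F) = σ.permMatrix F := rfl

/-- Permutation matrices lie in `GL_n(𝒪)`. [folklore] -/
theorem permGL_mem_glInt (σ : Equiv.Perm (Fin n)) : (permGL σ : GL (Fin n) F) ∈ glInt n F := by
  refine mem_glInt_of_isIntegralMatrix (fun i j => ?_) ?_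
  · rw [coe_permGL, permMatrix_apply']
    split_ifs
    · exact Subring.one_mem _
    · exact Subring.zero_mem _
  · rw [coe_permGL, Matrix.det_permutation]
    rcases Int.units_eq_one_or (Equiv.Perm.sign σ) with h | h <;> simp [h]

omit [ValuativeRel F] in
/-- `P_σ · diag(d) = diag(d ∘ σ) · P_σ`. [folklore] -/
theorem permMatrix_mul_diagonal (σ : Equiv.Perm (Fin n)) (d : Fin n → F) :
    σ.permMatrix F * Matrix.diagonal d = Matrix.diagonal (d ∘ σ) * σ.permMatrix F := by
  ext i j
  simp only [Matrix.mul_apply, permMatrix_apply', Matrix.diagonal_apply, Function.comp_apply]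
  rw [Finset.sum_eq_single (σ i), Finset.sum_eq_single i]
  · by_cases h : σ i = j
    · subst h; simp
    · simp [h]
  · intro l _ hl; simp [Ne.symm hl]
  · intro h; exact absurd (Finset.mem_univ i) h
  · intro l _ hl; simp [Ne.symm hl]
  · intro h; exact absurd (Finset.mem_univ _) h

/-- If `#S = n - r ≤ n` there is a permutation `σ` of `Fin n` with `σ i < r ↔ i ∉ S`. [folklore] -/
theorem exists_perm_lt_iff_not_mem {S : Finset (Fin n)} {r : ℕ} (hr : r ≤ n) (hS : S.card = n - r) :
    ∃ σ : Equiv.Perm (Fin n), ∀ i, ((σ i : ℕ) < r ↔ i ∉ S) := by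
  classical
  have hB : Fintype.card {l : Fin n // ¬ (r ≤ (l : ℕ))} = r := by
    rw [Fintype.card_congr (Equiv.subtypeEquivRight (fun l : Fin n => (not_le (a := r) (b :=
        (l : ℕ))))),
      Fintype.card_fin_lt_of_le hr]
  have hle : Fintype.card {l : Fin n // r ≤ (l : ℕ)} ≤ n :=
    (Fintype.card_subtype_le _).trans (by rw [Fintype.card_fin])
  have hcomp := Fintype.card_subtype_compl (fun l : Fin n => r ≤ (l : ℕ))
  rw [Fintype.card_fin, hB] at hcomp
  have hc1 : Fintype.card {i : Fin n // i ∈ S} = Fintype.card {l : Fin n // r ≤ (l : ℕ)} := by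
    rw [Fintype.card_coe, hS]
    omega
  have hc2 : Fintype.card {i : Fin n // i ∉ S} = Fintype.card {l : Fin n // ¬ (r ≤ (l : ℕ))} := by
    rw [Fintype.card_subtype_compl, Fintype.card_coe, hS, Fintype.card_fin, hB]
    omega
  obtain ⟨e₂⟩ := Fintype.card_eq.mp hc1
  obtain ⟨e₁⟩ := Fintype.card_eq.mp hc2
  refine ⟨(Equiv.sumCompl fun i : Fin n => i ∈ S).symm.trans
    ((Equiv.sumCongr e₂ e₁).trans (Equiv.sumCompl fun l : Fin n => r ≤ (l : ℕ))), fun i => ?_⟩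
  by_cases hi : i ∈ S
  · simp only [Equiv.trans_apply, Equiv.sumCompl_symm_apply_of_pos hi, Equiv.sumCongr_apply,
      Sum.map_inl, Equiv.sumCompl_apply_inl]
    constructor
    · intro h; exact absurd (e₂ ⟨i, hi⟩).2 (not_le.mpr h)
    · intro h; exact absurd hi h
  · simp only [Equiv.trans_apply, Equiv.sumCompl_symm_apply_of_neg hi, Equiv.sumCongr_apply,
      Sum.map_inr, Equiv.sumCompl_apply_inr]
    exact ⟨fun _ => hi, fun _ => not_le.mp (e₁ ⟨i, hi⟩).2⟩

omit [ValuativeRel F] in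
/-- `P_σ t_r = ϖ^{ε_S} P_σ` for `σ` as in `exists_perm_lt_iff_not_mem`, `t_r = diag(ϖ 1_r,
1_{n-r})` (`heckeDiag`). [folklore] -/
theorem permGL_mul_heckeDiag {S : Finset (Fin n)} {r : ℕ} {σ : Equiv.Perm (Fin n)}
    (hσ : ∀ i, ((σ i : ℕ) < r ↔ i ∉ S)) (ϖ : Fˣ) :
    (permGL σ : GL (Fin n) F) * heckeDiag n ϖ r = piPowGL ϖ.ne_zero (epsOf S) * permGL σ := by
  refine Units.ext ?_
  rw [Units.val_mul, Units.val_mul, coe_permGL, coe_heckeDiag, coe_piPowGL, permMatrix_mul_diagonal]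
  congr 1
  unfold piPow
  congr 1
  funext i
  simp only [Function.comp_apply, epsOf]
  by_cases hi : i ∈ S
  · rw [if_neg (fun h => (hσ i).mp h hi), if_pos hi, pow_zero]
  · rw [if_pos ((hσ i).mpr hi), if_neg hi, pow_one]

/-- **The representatives lie in the double coset**: `(u_a ϖ^{ε_S}) K₀ ∈ K₀ · t_r K₀` for `#S = n
- r` (`K₀ = GL_n(𝒪)`), since `u_a ϖ^{ε_S} = (u_a P_σ) t_r P_σ⁻¹`. [folklore] -/
theorem heckeRep_mem_orbit {ϖ : F} (hϖ : IsUniformizingElement ϖ) {S : Finset (Fin n)}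
    {ā : Fin n → Fin n → 𝓀[F]} (h : IsEchelonData S ā) {r : ℕ} (hr : r ≤ n) (hS : S.card = n - r) :
    ((heckeRep hϖ.ne_zero h : GL (Fin n) F) : GL (Fin n) F ⧸ glInt n F) ∈
      MulAction.orbit (glInt n F) ((heckeDiag n (Units.mk0 ϖ hϖ.ne_zero) r : GL (Fin n) F) :
        GL (Fin n) F ⧸ glInt n F) := by
  obtain ⟨σ, hσ⟩ := exists_perm_lt_iff_not_mem hr hS
  refine ⟨⟨echelonGL h * permGL σ, Subgroup.mul_mem _ (echelonGL_mem_glInt h)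
      (permGL_mem_glInt σ)⟩, ?_⟩
  change ((echelonGL h * permGL σ : GL (Fin n) F)) •
      ((heckeDiag n (Units.mk0 ϖ hϖ.ne_zero) r : GL (Fin n) F) : GL (Fin n) F ⧸ glInt n F) = _
  rw [MulAction.Quotient.smul_mk, QuotientGroup.eq, smul_eq_mul]
  have key : (echelonGL h * permGL σ) * heckeDiag n (Units.mk0 ϖ hϖ.ne_zero) r =
      heckeRep hϖ.ne_zero h * permGL σ := by
    rw [mul_assoc, permGL_mul_heckeDiag hσ, ← mul_assoc, heckeRep_eq_mul]
    rfl
  rw [key, _root_.mul_inv_rev, inv_mul_cancel_right]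
  exact Subgroup.inv_mem _ (permGL_mem_glInt σ)

end Literature.NumberTheory.Automorphic

/-! ## Injectivity and surjectivity of the representatives -/

namespace Literature.NumberTheory.Automorphic

open ValuativeRel Matrix Finset Echelon Literature.LinearAlgebra.Matrix.Echelon

variable {F : Type*} [Field F] [ValuativeRel F] {n : ℕ}

/-! ### Matrix formulas for `rep⁻¹` -/

omit [ValuativeRel F] in
/-- `(diag(c) N diag(d))_{ij} = c_i N_{ij} d_j`. [folklore] -/
theorem diagonal_mul_mul_diagonal_apply (c d : Fin n → F) (N : Matrix (Fin n) (Fin n) F)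
    (i j : Fin n) :
    (Matrix.diagonal c * N * Matrix.diagonal d) i j = c i * N i j * d j := by
  rw [Matrix.mul_diagonal, Matrix.diagonal_mul]

/-- `(u_a ϖ^ε)⁻¹ = ϖ^{-ε} u_{-a}`. [folklore] -/
theorem inv_heckeRepMatrix {ϖ : F} (hϖ : ϖ ≠ 0) {S : Finset (Fin n)} {ā : Fin n → Fin n → 𝓀[F]}
    (h : IsEchelonData S ā) :
    (heckeRepMatrix ϖ S ā)⁻¹ =
      Matrix.diagonal (fun i => (ϖ ^ epsOf S i)⁻¹) * echelonMatrix (-liftTable ā) := by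
  refine Matrix.inv_eq_left_inv ?_
  unfold heckeRepMatrix piPow
  rw [Matrix.mul_assoc, ← Matrix.mul_assoc (echelonMatrix (-liftTable ā)),
    echelonMatrix_neg_mul (isEchelonData_liftTable h).isEchelonSupported, Matrix.one_mul,
    Matrix.diagonal_mul_diagonal, ← Matrix.diagonal_one]
  congr 1
  funext i
  rw [inv_mul_cancel₀ (pow_ne_zero _ hϖ)]

/-- Entries of `(u_a ϖ^ε)⁻¹ N diag(d)`. [folklore] -/
theorem inv_heckeRepMatrix_mul_apply {ϖ : F} (hϖ : ϖ ≠ 0) {S : Finset (Fin n)}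
    {ā : Fin n → Fin n → 𝓀[F]} (h : IsEchelonData S ā) (N : Matrix (Fin n) (Fin n) F)
    (d : Fin n → F) (i j : Fin n) :
    ((heckeRepMatrix ϖ S ā)⁻¹ * N * Matrix.diagonal d) i j =
      (ϖ ^ epsOf S i)⁻¹ * (echelonMatrix (-liftTable ā) * N) i j * d j := by
  rw [inv_heckeRepMatrix hϖ h, Matrix.mul_assoc (Matrix.diagonal _),
      diagonal_mul_mul_diagonal_apply]

/-- Entries of `rep(S, ā)⁻¹ rep(S', ā')`. [folklore] -/
theorem inv_heckeRepMatrix_mul_heckeRepMatrix_apply {ϖ : F} (hϖ : ϖ ≠ 0) {S : Finset (Fin n)}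
    {ā : Fin n → Fin n → 𝓀[F]} (h : IsEchelonData S ā) (S' : Finset (Fin n))
    (ā' : Fin n → Fin n → 𝓀[F]) (i j : Fin n) :
    ((heckeRepMatrix ϖ S ā)⁻¹ * heckeRepMatrix ϖ S' ā') i j =
      (ϖ ^ epsOf S i)⁻¹ * (echelonMatrix (-liftTable ā) * echelonMatrix (liftTable ā')) i j *
        ϖ ^ epsOf S' j := by
  rw [show heckeRepMatrix ϖ S' ā' = echelonMatrix (liftTable ā') *
      Matrix.diagonal (fun j => ϖ ^ epsOf S' j) from rfl, ← Matrix.mul_assoc,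
    inv_heckeRepMatrix_mul_apply hϖ h]

omit [ValuativeRel F] in
/-- A product of two echelon unipotents (tables supported strictly above the diagonal) has
diagonal entries `1`. [folklore] -/
theorem echelonMatrix_mul_apply_self {a b : Fin n → Fin n → F} (ha : ∀ i j, a i j ≠ 0 → i < j)
    (hb : ∀ i j, b i j ≠ 0 → i < j) (i : Fin n) : (echelonMatrix a * echelonMatrix b) i i = 1 := by
  rw [Matrix.mul_apply, Finset.sum_eq_single i]
  · simp
  · intro l _ hl
    rcases lt_or_gt_of_ne hl with hlt | hgt
    · -- l < i: b l i may be nonzero but a i l = 0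
      rw [echelonMatrix_apply_of_ne _ (ne_of_gt hlt)]
      have : a i l = 0 := by by_contra hne; exact absurd (ha i l hne) (not_lt.mpr hlt.le)
      rw [this, zero_mul]
    · rw [echelonMatrix_apply_of_ne b (ne_of_gt hgt)]
      have : b l i = 0 := by by_contra hne; exact absurd (hb l i hne) (not_lt.mpr hgt.le)
      rw [this, mul_zero]
  · intro hi; exact absurd (Finset.mem_univ i) hi

omit [ValuativeRel F] in
/-- Negation preserves support strictly above the diagonal. [folklore] -/
theorem neg_supported_lt {a : Fin n → Fin n → F} (ha : ∀ i j, a i j ≠ 0 → i < j) :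
    ∀ i j, (-a) i j ≠ 0 → i < j := fun i j hij => ha i j (by simpa using hij)

/-- If `rep(S, ā)⁻¹ rep(S', ā') ∈ K₀` then `S' ⊆ S` (a diagonal entry `ϖ⁻¹` is not integral).
[folklore] -/
theorem subset_of_inv_heckeRep_mul_heckeRep_mem {ϖ : F}
    (hϖ : IsUniformizingElement ϖ) {S S' : Finset (Fin n)}
    {ā ā' : Fin n → Fin n → 𝓀[F]} (h : IsEchelonData S ā) (h' : IsEchelonData S' ā')
    (hK : (heckeRep hϖ.ne_zero h)⁻¹ * heckeRep hϖ.ne_zero h' ∈ glInt n F) : S' ⊆ S := by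
  intro i hi'
  by_contra hi
  have hint := isIntegralMatrix_of_mem_glInt hK i i
  rw [Units.val_mul, Matrix.coe_units_inv, coe_heckeRep, coe_heckeRep,
    inv_heckeRepMatrix_mul_heckeRepMatrix_apply hϖ.ne_zero h, echelonMatrix_mul_apply_self
      (neg_supported_lt fun i j hij => (isEchelonData_liftTable h i j hij).1)
      (fun i j hij => (isEchelonData_liftTable h' i j hij).1),
    mul_one, epsOf_of_not_mem hi, epsOf_of_mem hi', pow_one, pow_zero, mul_one] at hint
  exact hϖ.inv_not_mem hint

/-- **Injectivity**: `rep(S, ā) K₀ = rep(S', ā') K₀` forces `S = S'` and `ā = ā'` (the `(i, j)`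
entry of `rep⁻¹ rep'` is `ϖ⁻¹(a'_{ij} - a_{ij})`, integral only if the residues agree).
[folklore] -/
theorem eq_of_inv_heckeRep_mul_heckeRep_mem {ϖ : F} (hϖ : IsUniformizingElement ϖ) {S S' : Finset
    (Fin n)}
    {ā ā' : Fin n → Fin n → 𝓀[F]} (h : IsEchelonData S ā) (h' : IsEchelonData S' ā')
    (hK : (heckeRep hϖ.ne_zero h)⁻¹ * heckeRep hϖ.ne_zero h' ∈ glInt n F) : S = S' ∧ ā = ā' := by
  have hK' : (heckeRep hϖ.ne_zero h')⁻¹ * heckeRep hϖ.ne_zero h ∈ glInt n F := by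
    have := Subgroup.inv_mem _ hK
    rwa [_root_.mul_inv_rev, inv_inv] at this
  have hSS : S = S' :=
    Finset.Subset.antisymm (subset_of_inv_heckeRep_mul_heckeRep_mem hϖ h' h hK')
      (subset_of_inv_heckeRep_mul_heckeRep_mem hϖ h h' hK)
  subst hSS
  refine ⟨rfl, funext fun i => funext fun j => ?_⟩
  by_cases hi : i ∈ S
  · rw [h.apply_eq_zero_of_mem hi, h'.apply_eq_zero_of_mem hi]
  by_cases hj : j ∈ S
  swap
  · have h1 : ā i j = 0 := by by_contra hne; exact hj (h i j hne).2.2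
    have h2 : ā' i j = 0 := by by_contra hne; exact hj (h' i j hne).2.2
    rw [h1, h2]
  have hij : i ≠ j := fun e => hi (e ▸ hj)
  -- the `(i, j)` entry of `rep⁻¹ rep'` is `ϖ⁻¹ (a'_{ij} - a_{ij})`
  have hint := isIntegralMatrix_of_mem_glInt hK i j
  rw [Units.val_mul, Matrix.coe_units_inv, coe_heckeRep, coe_heckeRep,
    inv_heckeRepMatrix_mul_heckeRepMatrix_apply hϖ.ne_zero h,
    echelonMatrix_mul (isEchelonData_liftTable h).isEchelonSupported.neg
        (isEchelonData_liftTable h').isEchelonSupported,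
    echelonMatrix_apply_of_ne _ hij, epsOf_of_not_mem hi, epsOf_of_mem hj, pow_one, pow_zero,
        mul_one,
    Pi.add_apply, Pi.add_apply, Pi.neg_apply, Pi.neg_apply] at hint
  -- so `a'_{ij} - a_{ij}` has valuation `< 1`, hence residue `0`
  have hmem : -liftTable ā i j + liftTable ā' i j ∈ 𝒪[F] :=
    Subring.add_mem _ (Subring.neg_mem _ (liftTable_mem ā i j)) (liftTable_mem ā' i j)
  have hlt : valuation F (-liftTable ā i j + liftTable ā' i j) < 1 := by
    have hv := (Valuation.mem_integer_iff _ _).mp hint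
    rw [map_mul, map_inv₀] at hv
    have hϖpos : 0 < valuation F ϖ := (Valuation.pos_iff _).mpr hϖ.ne_zero
    calc valuation F (-liftTable ā i j + liftTable ā' i j)
        = valuation F ϖ * ((valuation F ϖ)⁻¹ * valuation F (-liftTable ā i j + liftTable ā' i j))
            := by
          rw [← mul_assoc, mul_inv_cancel₀ hϖpos.ne', one_mul]
      _ ≤ valuation F ϖ * 1 := by gcongr
      _ < 1 := by rw [mul_one]; exact hϖ.valuation_lt_one
  have hres := residue_eq_zero_of_valuation_lt_one (x := ⟨_, hmem⟩) hlt
  have e : (⟨-liftTable ā i j + liftTable ā' i j, hmem⟩ : 𝒪[F]) =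
      -⟨liftTable ā i j, liftTable_mem ā i j⟩ + ⟨liftTable ā' i j, liftTable_mem ā' i j⟩ := rfl
  rw [e, map_add, map_neg, residue_liftTable, residue_liftTable, neg_add_eq_zero] at hres
  exact hres


/-! ### Surjectivity -/

/-- The residue matrix `k̄ ∈ M_n(𝓀)` of `k ∈ GL_n(𝒪)`. [folklore] -/
noncomputable def residueMatrix {k : GL (Fin n) F} (hk : k ∈ glInt n F) : Matrix (Fin n)
    (Fin n) 𝓀[F] :=
  Matrix.of fun i j => IsLocalRing.residue 𝒪[F] ⟨(k : Matrix (Fin n) (Fin n) F) i j,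
    isIntegralMatrix_of_mem_glInt hk i j⟩

/-- The matrix of `k ∈ GL_n(𝒪)` with entries in `𝒪`. [folklore] -/
noncomputable def integralModelGL {k : GL (Fin n) F} (hk : k ∈ glInt n F) : Matrix (Fin n)
    (Fin n) 𝒪[F] :=
  Matrix.of fun i j => ⟨(k : Matrix (Fin n) (Fin n) F) i j, isIntegralMatrix_of_mem_glInt hk i j⟩

/-- `integralModelGL` maps to the matrix of `k`. [folklore] -/
theorem map_integralModelGL {k : GL (Fin n) F} (hk : k ∈ glInt n F) :
    (integralModelGL hk).map (𝒪[F]).subtype = (k : Matrix (Fin n) (Fin n) F) := by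
  ext i j; rfl

/-- `residueMatrix` is the entrywise residue of `integralModelGL`. [folklore] -/
theorem residueMatrix_eq_map {k : GL (Fin n) F} (hk : k ∈ glInt n F) :
    residueMatrix hk = (integralModelGL hk).map (IsLocalRing.residue 𝒪[F]) := by
  ext i j; rfl

/-- `k̄` is invertible for `k ∈ GL_n(𝒪)` (`det k` is a unit). [folklore] -/
theorem det_residueMatrix_ne_zero {k : GL (Fin n) F} (hk : k ∈ glInt n F) :
    (residueMatrix hk).det ≠ 0 := by
  rw [residueMatrix_eq_map, ← RingHom.mapMatrix_apply, ← RingHom.map_det]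
  intro h0
  have hlt := valuation_lt_one_of_residue_eq_zero h0
  have hdet : ((integralModelGL hk).det : F) = (k : Matrix (Fin n) (Fin n) F).det := by
    rw [← map_integralModelGL hk, ← RingHom.mapMatrix_apply, ← RingHom.map_det]; rfl
  rw [hdet, valuation_det_eq_one_of_mem_glInt hk] at hlt
  exact lt_irrefl _ hlt

/-- The matrix `u_{-a}` over `𝒪` for a lifted residue table. [folklore] -/
noncomputable def negEchelonModel (ā : Fin n → Fin n → 𝓀[F]) : Matrix (Fin n) (Fin n) 𝒪[F] :=
  Matrix.of fun i j => if i = j then 1 else -liftRes (ā i j)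

/-- `negEchelonModel` maps to `u_{-a}` over `F`. [folklore] -/
theorem map_negEchelonModel (ā : Fin n → Fin n → 𝓀[F]) :
    (negEchelonModel ā).map (𝒪[F]).subtype = echelonMatrix (-liftTable ā) := by
  ext i j
  by_cases h : i = j
  · subst h; simp [negEchelonModel]
  · rw [Matrix.map_apply, echelonMatrix_apply_of_ne _ h]
    simp [negEchelonModel, h, liftTable]

/-- The residue of `negEchelonModel ā` is `u_{-ā}` over `𝓀`. [folklore] -/
theorem residue_map_negEchelonModel (ā : Fin n → Fin n → 𝓀[F]) :
    (negEchelonModel ā).map (IsLocalRing.residue 𝒪[F]) = echelonMatrix (-ā) := by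
  ext i j
  by_cases h : i = j
  · subst h; simp [negEchelonModel]
  · rw [Matrix.map_apply, echelonMatrix_apply_of_ne _ h]
    simp [negEchelonModel, h]

/-- `u_{-ā}` maps the span of the echelon vectors `v_j` (`j ∈ S`) into the coordinate subspace
spanned by `e_j`, `j ∈ S`: the non-pivot coordinates of `u_{-ā} x` vanish (`u_{-ā} v_j =
e_j`). [folklore] -/
theorem echelonMatrix_neg_mulVec_apply_eq_zero {S : Finset (Fin n)} {ā : Fin n → Fin n → 𝓀[F]}
    (h : IsEchelonData S ā) {x : Fin n → 𝓀[F]}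
    (hx : x ∈ Submodule.span 𝓀[F] (echelonVec ā '' (S : Set (Fin n)))) {i : Fin n} (hi : i ∉ S) :
    (echelonMatrix (-ā) *ᵥ x) i = 0 := by
  induction hx using Submodule.span_induction with
  | mem y hy =>
    obtain ⟨s, hs, rfl⟩ := hy
    rw [← echelonMatrix_mulVec_single, Matrix.mulVec_mulVec,
        echelonMatrix_neg_mul h.isEchelonSupported,
      Matrix.one_mulVec, Pi.single_apply, if_neg (by rintro rfl; exact hi hs)]
  | zero => simp
  | add y z _ _ hy hz => rw [Matrix.mulVec_add, Pi.add_apply, hy, hz, add_zero]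
  | smul c y _ hy => rw [Matrix.mulVec_smul, Pi.smul_apply, hy, smul_zero]

omit [ValuativeRel F] in
/-- `det t_r = ϖ^r` for `r ≤ n`. [folklore] -/
theorem det_heckeDiag_coe (ϖ : Fˣ) {r : ℕ} (hr : r ≤ n) :
    ((heckeDiag n ϖ r : GL (Fin n) F) : Matrix (Fin n) (Fin n) F).det = (ϖ : F) ^ r := by
  rw [coe_heckeDiag, Matrix.det_diagonal, Finset.prod_ite, Finset.prod_const_one, mul_one,
    Finset.prod_const]
  congr 1
  rw [← Fintype.card_subtype]
  exact Fintype.card_fin_lt_of_le hr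

/-- **Surjectivity**: for `k ∈ K₀ = GL_n(𝒪)` and `r ≤ n` there are reduced echelon data `(S, ā)`
with `#S = n - r` and `rep(S, ā)⁻¹ k t_r ∈ K₀`. Proof: `(S, ā)` is the reduced echelon basis
(`exists_echelon_basis`) of the span of the last `n - r` columns of the residue matrix `k̄`;
then `ϖ^{-ε_S} u_{-a} k t_r` is integral (the rows `i ∉ S` of `u_{-a} k` have residue `0` in
the columns `≥ r`) with unit determinant. [folklore] -/
theorem exists_heckeRep_inv_mul_mem {ϖ : F} (hϖ : IsUniformizingElement ϖ) {r : ℕ} (hr : r ≤ n)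
    {k : GL (Fin n) F} (hk : k ∈ glInt n F) :
    ∃ (S : Finset (Fin n)) (ā : Fin n → Fin n → 𝓀[F]) (h : IsEchelonData S ā), S.card = n - r ∧
      (heckeRep hϖ.ne_zero h)⁻¹ * (k * heckeDiag n (Units.mk0 ϖ hϖ.ne_zero) r) ∈ glInt n F := by
  classical
  -- the span of the last `n - r` columns of the residue matrix
  set kb := residueMatrix hk with hkb
  set V : Submodule 𝓀[F] (Fin n → 𝓀[F]) :=
    Submodule.span 𝓀[F] (Set.range fun j : {j : Fin n // r ≤ (j : ℕ)} => kb.col j) with hV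
  have hind : LinearIndependent 𝓀[F] (fun j : {j : Fin n // r ≤ (j : ℕ)} => kb.col j) :=
    (Matrix.linearIndependent_cols_of_det_ne_zero (det_residueMatrix_ne_zero hk)).comp _
      Subtype.val_injective
  have hdim : Module.finrank 𝓀[F] V = n - r := by
    rw [hV, finrank_span_eq_card hind]
    have hB : Fintype.card {l : Fin n // ¬ (r ≤ (l : ℕ))} = r := by
      rw [Fintype.card_congr (Equiv.subtypeEquivRight
        (fun l : Fin n => (not_le (a := r) (b := (l : ℕ))))), Fintype.card_fin_lt_of_le hr]
    have hcomp := Fintype.card_subtype_compl (fun l : Fin n => r ≤ (l : ℕ))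
    have hle : Fintype.card {l : Fin n // r ≤ (l : ℕ)} ≤ n :=
      (Fintype.card_subtype_le _).trans (by rw [Fintype.card_fin])
    rw [Fintype.card_fin, hB] at hcomp
    omega
  obtain ⟨S, ā, hd, hspan, _, hcard⟩ := exists_echelon_basis V
  rw [hdim] at hcard
  refine ⟨S, ā, hd, hcard, ?_⟩
  -- the candidate `M = rep⁻¹ k t`
  refine mem_glInt_of_isIntegralMatrix (fun i j => ?_) ?_
  · -- integrality of the entries
    rw [Units.val_mul, Units.val_mul, Matrix.coe_units_inv, coe_heckeRep, coe_heckeDiag,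
        ← Matrix.mul_assoc,
      inv_heckeRepMatrix_mul_apply hϖ.ne_zero hd]
    set N := echelonMatrix (-liftTable ā) * (k : Matrix (Fin n) (Fin n) F) with hN
    have hNint : IsIntegralMatrix N := by
      rw [hN, ← map_negEchelonModel, ← map_integralModelGL hk, ← Matrix.map_mul]
      intro i j
      exact ((negEchelonModel ā * integralModelGL hk) i j).2
    by_cases hi : i ∈ S
    · rw [epsOf_of_mem hi, pow_zero, inv_one, one_mul]
      refine Subring.mul_mem _ (hNint i j) ?_
      split_ifs
      · exact hϖ.mem
      · exact Subring.one_mem _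
    rw [epsOf_of_not_mem hi, pow_one]
    by_cases hj : (j : ℕ) < r
    · rw [if_pos hj, Units.val_mk0, mul_assoc, mul_comm (N i j), ← mul_assoc,
        inv_mul_cancel₀ hϖ.ne_zero,
        one_mul]
      exact hNint i j
    · rw [if_neg hj, mul_one]
      refine hϖ.inv_mul_mem (hNint i j) ?_
      -- the residue of `N i j` vanishes: `u_{-ā} k̄ e_j` is supported on `S` for `j ≥ r`
      have hres : IsLocalRing.residue 𝒪[F] ⟨N i j, hNint i j⟩ = 0 := by
        have e1 : (⟨N i j, hNint i j⟩ : 𝒪[F]) = (negEchelonModel ā * integralModelGL hk) i j := by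
          apply Subtype.ext
          change N i j = ((negEchelonModel ā * integralModelGL hk) i j : F)
          rw [hN, ← map_negEchelonModel, ← map_integralModelGL hk, ← Matrix.map_mul]; rfl
        rw [e1, ← Matrix.map_apply (f := IsLocalRing.residue 𝒪[F]), Matrix.map_mul,
          residue_map_negEchelonModel, ← residueMatrix_eq_map]
        have hcol : kb.col j ∈ V := by
          rw [hV]
          exact Submodule.subset_span ⟨⟨j, not_lt.mp hj⟩, rfl⟩
        rw [← hspan] at hcol
        have := echelonMatrix_neg_mulVec_apply_eq_zero hd hcol hi
        rwa [Matrix.mulVec, hkb] at this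
      exact valuation_lt_one_of_residue_eq_zero hres
  · -- the determinant
    rw [Units.val_mul, Units.val_mul, Matrix.coe_units_inv, coe_heckeRep, Matrix.det_mul,
        Matrix.det_mul,
      Matrix.det_nonsing_inv, det_heckeRepMatrix ϖ hd, hcard, Nat.sub_sub_self hr,
          det_heckeDiag_coe _ hr,
      Units.val_mk0, Ring.inverse_eq_inv', map_mul, map_mul, map_inv₀,
      valuation_det_eq_one_of_mem_glInt hk, one_mul, inv_mul_cancel₀]
    exact (map_ne_zero _).mpr (pow_ne_zero _ hϖ.ne_zero)

end Literature.NumberTheory.Automorphic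

/-! ## The transversal and the Hecke operator -/

namespace Literature.NumberTheory.Automorphic

open ValuativeRel Matrix Finset Echelon Literature.LinearAlgebra.Matrix.Echelon

variable {F : Type*} [Field F] [ValuativeRel F] {n : ℕ}

/-- Index set of the transversal of `K₀ t_r K₀ / K₀`: pivot sets `S` with `#S = n - r` and reduced
echelon tables `ā` over `𝓀`. [folklore] -/
def TransversalIndex (n : ℕ) (F : Type*) [Field F] [ValuativeRel F] (r : ℕ) : Type _ :=
  {p : Finset (Fin n) × (Fin n → Fin n → 𝓀[F]) // p.1.card = n - r ∧ IsEchelonData p.1 p.2}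

/-- `TransversalIndex` is finite for a finite residue field. [folklore] -/
noncomputable instance [Finite 𝓀[F]] (r : ℕ) : Fintype (TransversalIndex n F r) := by
  haveI : Finite (TransversalIndex n F r) := Subtype.finite
  exact Fintype.ofFinite _

/-- The representative `u_a ϖ^{ε_S}` of an index. [folklore] -/
noncomputable def TransversalIndex.rep {ϖ : F} (hϖ : ϖ ≠ 0) {r : ℕ} (p : TransversalIndex n F r) :
    GL (Fin n) F :=
  Literature.NumberTheory.Automorphic.heckeRep hϖ p.2.2

/-- Distinct indices give distinct representatives. [folklore] -/
theorem TransversalIndex.rep_injective {ϖ : F} (hϖ : IsUniformizingElement ϖ) {r : ℕ} :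
    Function.Injective (TransversalIndex.rep (n := n) (F := F) hϖ.ne_zero (r := r)) := by
  rintro ⟨⟨S, ā⟩, hS, h⟩ ⟨⟨S', ā'⟩, hS', h'⟩ hpp
  have hK : (Literature.NumberTheory.Automorphic.heckeRep hϖ.ne_zero h)⁻¹ * Literature.NumberTheory.Automorphic.heckeRep hϖ.ne_zero h' ∈
      glInt n F := by
    change (Literature.NumberTheory.Automorphic.heckeRep hϖ.ne_zero h)⁻¹ * TransversalIndex.rep hϖ.ne_zero ⟨(S', ā'),
        hS', h'⟩ ∈ _
    rw [← hpp]
    change (Literature.NumberTheory.Automorphic.heckeRep hϖ.ne_zero h)⁻¹ * Literature.NumberTheory.Automorphic.heckeRep hϖ.ne_zero h ∈ _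
    rw [inv_mul_cancel]
    exact Subgroup.one_mem _
  obtain ⟨rfl, rfl⟩ := eq_of_inv_heckeRep_mul_heckeRep_mem hϖ h h' hK
  rfl

/-- **The transversal** `{u_a ϖ^{ε_S}}` of `K₀ t_r K₀ / K₀` as a finset (finite residue field).
[folklore] -/
noncomputable def heckeTransversal [Finite 𝓀[F]] {ϖ : F} (hϖ : ϖ ≠ 0) (r : ℕ) :
    Finset (GL (Fin n) F) := by
  classical
  exact (Finset.univ : Finset (TransversalIndex n F r)).image (TransversalIndex.rep hϖ)

/-- Membership in `heckeTransversal`. [folklore] -/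
theorem mem_heckeTransversal_iff [Finite 𝓀[F]] {ϖ : F} (hϖ : ϖ ≠ 0) {r : ℕ} {y : GL (Fin n) F} :
    y ∈ heckeTransversal (n := n) hϖ r ↔ ∃ p : TransversalIndex n F r, p.rep hϖ = y := by
  classical
  unfold heckeTransversal
  simp

/-- **Theorem (left cosets of the Hecke double coset).** For `ϖ` uniformizing and `r ≤ n`, `y ↦ y
K₀` is a bijection from `heckeTransversal` onto the `K₀`-orbit of `t_r K₀` in `GL_n(F) ⧸ K₀`,
i.e. `K₀ diag(ϖ 1_r, 1_{n-r}) K₀ = ⨆_{(S, ā)} u_a ϖ^{ε_S} K₀` — the hypothesis `Set.BijOn` of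
`heckeOperator_apply_eq_sum` (`HeckeAlgebra`). Classical (Shimura §3.2; Miyauchi 2014, Lemma
2, for an inductive form of the same system). [cite: Miyauchi2014, Lemma 2] -/
theorem bijOn_heckeTransversal [Finite 𝓀[F]] {ϖ : F} (hϖ : IsUniformizingElement ϖ) {r : ℕ}
    (hr : r ≤ n) :
    Set.BijOn (fun y : GL (Fin n) F => (y : GL (Fin n) F ⧸ glInt n F))
      (heckeTransversal (n := n) hϖ.ne_zero r)
      (MulAction.orbit (glInt n F)
        ((heckeDiag n (Units.mk0 ϖ hϖ.ne_zero) r : GL (Fin n) F) : GL (Fin n) F ⧸ glInt n F)) := by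
  refine ⟨?_, ?_, ?_⟩
  · -- maps into the orbit
    intro y hy
    obtain ⟨⟨⟨S, ā⟩, hS, h⟩, rfl⟩ := (mem_heckeTransversal_iff hϖ.ne_zero).mp hy
    exact heckeRep_mem_orbit hϖ h hr hS
  · -- injective
    intro y hy y' hy' hyy
    obtain ⟨p, rfl⟩ := (mem_heckeTransversal_iff hϖ.ne_zero).mp hy
    obtain ⟨p', rfl⟩ := (mem_heckeTransversal_iff hϖ.ne_zero).mp hy'
    obtain ⟨⟨S, ā⟩, hS, h⟩ := p
    obtain ⟨⟨S', ā'⟩, hS', h'⟩ := p'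
    have hK := QuotientGroup.eq.mp hyy
    obtain ⟨rfl, rfl⟩ := eq_of_inv_heckeRep_mul_heckeRep_mem hϖ h h' hK
    rfl
  · -- surjective
    intro z hz
    obtain ⟨⟨k, hk⟩, rfl⟩ := hz
    obtain ⟨S, ā, h, hS, hM⟩ := exists_heckeRep_inv_mul_mem hϖ hr hk
    refine ⟨Literature.NumberTheory.Automorphic.heckeRep hϖ.ne_zero h, (mem_heckeTransversal_iff hϖ.ne_zero).mpr
      ⟨⟨(S, ā), hS, h⟩, rfl⟩, ?_⟩
    change ((Literature.NumberTheory.Automorphic.heckeRep hϖ.ne_zero h : GL (Fin n) F) : GL (Fin n) F ⧸ glInt n F) =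
      (k : GL (Fin n) F) • ((heckeDiag n (Units.mk0 ϖ hϖ.ne_zero) r : GL (Fin n) F) :
        GL (Fin n) F ⧸ glInt n F)
    rw [MulAction.Quotient.smul_mk, smul_eq_mul]
    exact QuotientGroup.eq.mpr hM

/-- Sums over the transversal are sums over `TransversalIndex`. [folklore] -/
theorem sum_heckeTransversal [Finite 𝓀[F]] {M : Type*} [AddCommMonoid M] {ϖ : F}
    (hϖ : IsUniformizingElement ϖ) (r : ℕ) (f : GL (Fin n) F → M) :
    ∑ y ∈ heckeTransversal (n := n) hϖ.ne_zero r, f y =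
      ∑ p : TransversalIndex n F r, f (p.rep hϖ.ne_zero) := by
  classical
  unfold heckeTransversal
  rw [Finset.sum_image fun p _ p' _ hpp => TransversalIndex.rep_injective hϖ hpp]

/-- **The Hecke operator `T_r` as an explicit finite sum**: for `v ∈ V^{K₀}`, `T_r v = ∑_{(S, ā)}
ρ(u_a ϖ^{ε_S}) v`. [folklore] -/
theorem heckeT_apply_eq_sum [Finite 𝓀[F]] {V : Type*} [AddCommGroup V] [Module ℂ V]
    (ρ : Representation ℂ (GL (Fin n) F) V) {ϖ : F} (hϖ : IsUniformizingElement ϖ) {r : ℕ}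
    (hr : r ≤ n) {v : V} (hv : v ∈ ρ.fixedPoints (glInt n F)) :
    heckeT ρ (Units.mk0 ϖ hϖ.ne_zero) r v =
      ∑ p : TransversalIndex n F r, ρ (p.rep hϖ.ne_zero) v := by
  rw [heckeT_def, heckeOperator_apply_eq_sum ρ (glInt n F) _ _ (bijOn_heckeTransversal hϖ hr) hv,
    sum_heckeTransversal hϖ]

/-! ### Counting: `#{ā} = q^{c(S)}` -/

/-- The positions `{(i, j) : i < j, i ∉ S, j ∈ S}` where an echelon table with pivots `S` may be
non-zero; their number `c(S)` is `∑_{i ∉ S} #{j ∈ S : j > i}`. [folklore] -/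
def echelonPositions (S : Finset (Fin n)) : Finset (Fin n × Fin n) :=
  Finset.univ.filter fun p => p.1 < p.2 ∧ p.1 ∉ S ∧ p.2 ∈ S

/-- Echelon tables with pivot set `S` ↔ arbitrary functions on `echelonPositions S`. [folklore] -/
noncomputable def echelonDataEquiv (k : Type*) [Field k] (S : Finset (Fin n)) :
    {ā : Fin n → Fin n → k // IsEchelonData S ā} ≃ (echelonPositions S → k) where
  toFun ā := fun p => ā.1 p.1.1 p.1.2
  invFun f := ⟨fun i j => if h : (i, j) ∈ echelonPositions S then f ⟨(i, j), h⟩ else 0, by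
    intro i j hij
    by_cases h : (i, j) ∈ echelonPositions S
    · simpa [echelonPositions] using h
    · simp [h] at hij⟩
  left_inv ā := by
    apply Subtype.ext
    funext i j
    simp only
    split_ifs with h
    · rfl
    · by_contra hne
      apply h
      have := ā.2 i j (Ne.symm hne)
      simpa [echelonPositions] using this
  right_inv f := by
    funext p
    simp only [p.2, dite_true]

/-- `#{ā : IsEchelonData S ā} = #k ^ c(S)`. [folklore] -/
theorem card_isEchelonData (k : Type*) [Field k] [Fintype k] (S : Finset (Fin n))
    [Fintype {ā : Fin n → Fin n → k // IsEchelonData S ā}] :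
    Fintype.card {ā : Fin n → Fin n → k // IsEchelonData S ā} =
      Fintype.card k ^ (echelonPositions S).card := by
  rw [Fintype.card_congr (echelonDataEquiv k S), Fintype.card_fun, Fintype.card_coe]

/-- **Counting the transversal by pivot sets**: `∑_{(S, ā)} g(S) = ∑_{#S = n - r} q^{c(S)} g(S)`,
`q = #𝓀` (so `#(K₀ t_r K₀ / K₀) = ∑_{#S = n-r} q^{c(S)}`, the Gaussian binomial coefficient).
[folklore] -/
theorem sum_transversalIndex_of_fst [Fintype 𝓀[F]] {M : Type*} [AddCommMonoid M] (r : ℕ)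
    (g : Finset (Fin n) → M) :
    ∑ p : TransversalIndex n F r, g p.1.1 =
      ∑ S ∈ (Finset.univ : Finset (Finset (Fin n))).filter (fun S => S.card = n - r),
        (Fintype.card 𝓀[F] ^ (echelonPositions S).card) • g S := by
  classical
  -- reindex by the sigma type over admissible `S`
  let e : TransversalIndex n F r ≃
      Σ S : {S : Finset (Fin n) // S.card = n - r},
          {ā : Fin n → Fin n → 𝓀[F] // IsEchelonData S.1 ā} :=
    { toFun := fun p => ⟨⟨p.1.1, p.2.1⟩, ⟨p.1.2, p.2.2⟩⟩
      invFun := fun q => ⟨(q.1.1, q.2.1), q.1.2, q.2.2⟩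
      left_inv := fun p => rfl
      right_inv := fun q => rfl }
  rw [← Equiv.sum_comp e.symm, Fintype.sum_sigma]
  simp only [e, Equiv.coe_fn_symm_mk]
  rw [Finset.sum_subtype (p := fun S : Finset (Fin n) => S.card = n - r)
    ((Finset.univ : Finset (Finset (Fin n))).filter (fun S => S.card = n - r)) (by simp)]
  refine Finset.sum_congr rfl fun S _ => ?_
  rw [Finset.sum_const, Finset.card_univ, card_isEchelonData]

end Literature.NumberTheory.Automorphic
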